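import Summits.BirchSwinnertonDyer.Rank1Residual.Additive.KatoDescentKatoRigidEvaluation
import Mathlib.RingTheory.PowerSeries.Substitution
import Mathlib.RingTheory.PowerSeries.Binomial
import Mathlib.RingTheory.PowerSeries.Derivative
import Mathlib.RingTheory.PowerSeries.NoZeroDivisors
import Mathlib.NumberTheory.Padics.MahlerBasis
import Mathlib.Tactic.LinearCombination
import Literature.Barriers.BirchSwinnertonDyer.PAdicFunctionalEquationParity
import HarnessLib

set_option autoImplicit false

/-!
# AUG engine, step 8: the GROUP-LIKE elements `(1 + T)^α ∈ Λ = ℤ_p⟦T⟧` (`α ∈ ℤ_p`) — `(1 + T)^α ≡ (1 + T)^a (mod ω_n)` for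
# `α ≡ a (mod p^n)`, hence `[γ^α](u − 1) = u^a` at every `u` with `u^{p^n} = 1`
# (seat `bsd-cm-prr-ty1` g14, cell `bsd-cm`; theorems only: no definition, no named fact, no instance, no `sorry`)

Part 50 of the seat's kernel cut of stub 3 (cruxes stmt-BirchSwinnertonDyer-19945 / -19223).  The successor's ENDGAME for AUG
(HOME `bsd-cm-prr-ty1/STUB3-CUT.md` §6 addendum 7) packages Kato's cusp factors `c²d² − cd²χ̄(c)… ` and the removed Euler
factors `1 − χ(ℓ)a_ℓ/ℓ + χ(ℓ)²/ℓ` as IWASAWA FUNCTIONS of the character `χ` of `Γ_n`; the only non-polynomial ingredient is the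
group-like element `[σ] ∈ Λ` of `σ = γ^α ∈ Γ ≅ ℤ_p`, i.e. Mathlib's binomial series `(1 + T)^α = Σ_k C(α,k) T^k`
(`PowerSeries.binomialSeries ℤ_[p] α`, `ℤ_p` a binomial ring by `PadicInt.instBinomialRing`).  To EVALUATE it at a character one
needs the congruence `(1 + T)^α ≡ (1 + T)^a (mod ω_n)` for `α ≡ a (mod p^n)`, which Mathlib lacks (it has `binomialSeries_add`,
`binomialSeries_nat` but no composition law).  THIS FILE proves it by the ODE method of the tree's barrier file
`Literature/Barriers/BirchSwinnertonDyer/PAdicFunctionalEquationParity.lean` (§ODE there: `(1 + T)·∂(1 + T)^b = b(1 + T)^b`), over `ℤ_p`: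
* §1 `one_add_X_mul_derivative_binomialSeries_padicInt` — the ODE over the binomial ring `ℤ_p`;
* §2 ★ `binomialSeries_subst_pow_sub_one` — the COMPOSITION LAW `(1 + ω_m)^β = (1 + T)^{mβ}`, `ω_m = (1 + T)^m − 1`
  (both solve `(1 + T)y′ = mβ·y`, `y(0) = 1`; chain rule `PowerSeries.derivative_subst`; uniqueness via
  `y·(1 + T)^{−mβ} = 1`, `PowerSeries.derivative.ext`);
* §3 `pow_sub_one_dvd_binomialSeries_sub_one` — `ω_m ∣ (1 + T)^{mβ} − 1` in `ℤ_p⟦T⟧`; ★ `binomialSeries_sub_pow_mem_span` —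
  `(1 + T)^α − (1 + T)^a ∈ (ω_n)` for `p^n ∣ α − a`, in the tree's shape `F − ↑r ∈ Ideal.span {↑ω_n}` (`r = (X + 1)^a ∈ ℤ_p[X]`);
* §4 ★ `aeval_eq_pow_of_binomialSeries` — with E34 `aeval_eq_aeval_of_sub_mem_span`: for every commutative `ℤ_p`-algebra `A`, `u ∈ A`
  with `u^{p^n} = 1` and every polynomial representative `r ≡ (1 + T)^α (mod ω_n)`: `r(u − 1) = u^a`.
HONEST LABEL: Iwasawa-algebra plumbing serving the seat's AUG engine; AUG displayed; no stub closed; nothing asserted on 19945 / 19223;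
BSD is not proved for any curve.
References: [Washington1997] §7.1–§7.2 (Λ ≅ ℤ_p⟦T⟧, `γ ↦ 1 + T`, distinguished polynomials), §13.1; [Lang1990] Ch. 5 §1;
Mathlib `RingTheory/PowerSeries/Binomial`, `NumberTheory/Padics/MahlerBasis`.
-/

noncomputable section

open PowerSeries

namespace Summit.BirchSwinnertonDyer.Rank1Residual.Additive.PerrinRiouUnit

variable {p : ℕ} [Fact p.Prime]

/-! ## §1 The ODE of the binomial series over `ℤ_p` -/

/-- Pascal/absorption: `(n + 2) C(b, n+2) + (n + 1) C(b, n+1) = b C(b, n+1)` in the binomial ring `ℤ_p`. [folklore] -/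
theorem succ_nsmul_choose_add_padicInt (b : ℤ_[p]) (n : ℕ) :
    (n + 2) • Ring.choose b (n + 2) + (n + 1) • Ring.choose b (n + 1) = b * Ring.choose b (n + 1) := by
  have h1 := Ring.choose_smul_choose b (show 1 ≤ n + 2 by omega)
  have h2 := Ring.choose_smul_choose b (show 1 ≤ n + 1 by omega)
  rw [Nat.choose_one_right, Ring.choose_one_right] at h1 h2
  rw [h1, h2, show n + 2 - 1 = n + 1 from rfl, show n + 1 - 1 = n from rfl, Nat.cast_one, ← mul_add]
  congr 1
  rw [add_comm, ← Ring.choose_succ_succ, sub_add_cancel]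

/-- **`(1 + T) · ∂(1 + T)^b = b · (1 + T)^b`** in `ℤ_p⟦T⟧`. [cite: Washington1997, §7.1] -/
theorem one_add_X_mul_derivative_binomialSeries_padicInt (b : ℤ_[p]) :
    (1 + X) * d⁄dX ℤ_[p] (binomialSeries ℤ_[p] b) = C b * binomialSeries ℤ_[p] b := by
  ext n
  rw [add_mul, one_mul, map_add, coeff_C_mul]
  rcases n with _ | n
  · rw [coeff_zero_X_mul, add_zero, coeff_derivative, binomialSeries_coeff, coeff_zero_eq_constantCoeff,
      binomialSeries_constantCoeff, Ring.choose_one_right]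
    simp
  · rw [coeff_succ_X_mul, coeff_derivative, coeff_derivative, binomialSeries_coeff,
      binomialSeries_coeff, smul_eq_mul, smul_eq_mul, mul_one, mul_one, ← succ_nsmul_choose_add_padicInt b n,
      nsmul_eq_mul, nsmul_eq_mul]
    push_cast
    ring

/-! ## §2 The composition law `(1 + ω_m)^β = (1 + T)^{mβ}` -/

/-- `ω_m = (1 + T)^m − 1` has zero constant term. [folklore] -/
theorem constantCoeff_one_add_X_pow_sub_one (m : ℕ) :
    constantCoeff (((1 : PowerSeries ℤ_[p]) + X) ^ m - 1) = 0 := by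
  simp

/-- `(1 + T) · ∂ω_m = m · (1 + ω_m)`. [folklore] -/
theorem one_add_X_mul_derivative_pow_sub_one (m : ℕ) :
    (1 + X) * d⁄dX ℤ_[p] (((1 : PowerSeries ℤ_[p]) + X) ^ m - 1) =
      C (m : ℤ_[p]) * (1 + ((((1 : PowerSeries ℤ_[p]) + X) ^ m - 1))) := by
  rw [map_sub, Derivation.map_one_eq_zero, sub_zero, Derivation.leibniz_pow, map_add, Derivation.map_one_eq_zero,
    derivative_X, zero_add, smul_eq_mul, mul_one, add_sub_cancel, map_natCast, nsmul_eq_mul]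
  rcases m with _ | m
  · simp
  · rw [Nat.add_sub_cancel, pow_succ]
    ring

/-- ★ **Composition law**: `((1 + T)^β)(ω_m) = (1 + T)^{mβ}` in `ℤ_p⟦T⟧`, `ω_m = (1 + T)^m − 1` — both sides solve
`(1 + T)y′ = mβ·y` with `y(0) = 1`. [cite: Washington1997, §7.1–§7.2] -/
theorem binomialSeries_subst_pow_sub_one (β : ℤ_[p]) (m : ℕ) :
    (binomialSeries ℤ_[p] β).subst (((1 : PowerSeries ℤ_[p]) + X) ^ m - 1) =
      binomialSeries ℤ_[p] ((m : ℤ_[p]) * β) := by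
  set ω : PowerSeries ℤ_[p] := ((1 : PowerSeries ℤ_[p]) + X) ^ m - 1 with hωdef
  set S : PowerSeries ℤ_[p] := binomialSeries ℤ_[p] β with hS
  set V : PowerSeries ℤ_[p] := binomialSeries ℤ_[p] ((m : ℤ_[p]) * β) with hV
  have hω0 : constantCoeff ω = 0 := constantCoeff_one_add_X_pow_sub_one m
  have hω : HasSubst ω := HasSubst.of_constantCoeff_zero' hω0
  -- the ODEs
  have hSode : (1 + X) * d⁄dX ℤ_[p] S = C β * S := one_add_X_mul_derivative_binomialSeries_padicInt β
  have hVode : (1 + X) * d⁄dX ℤ_[p] V = C ((m : ℤ_[p]) * β) * V :=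
    one_add_X_mul_derivative_binomialSeries_padicInt _
  have hωode : (1 + X) * d⁄dX ℤ_[p] ω = C (m : ℤ_[p]) * (1 + ω) := one_add_X_mul_derivative_pow_sub_one m
  -- substitute `ω` into the ODE of `S`: `(1 + ω) · S'(ω) = β · S(ω)`
  have hSodeω : (1 + ω) * (d⁄dX ℤ_[p] S).subst ω = C β * S.subst ω := by
    have h := congrArg (PowerSeries.subst ω) hSode
    rwa [subst_mul hω, subst_add hω, subst_X hω, ← coe_substAlgHom hω, map_one, coe_substAlgHom hω,
      ← smul_eq_C_mul, subst_smul hω, smul_eq_C_mul] at h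
  -- hence `W := S(ω)` solves the ODE of `V`
  have hWode : (1 + X) * d⁄dX ℤ_[p] (S.subst ω) = C ((m : ℤ_[p]) * β) * S.subst ω := by
    rw [derivative_subst _ hω, map_mul]
    linear_combination ((d⁄dX ℤ_[p] S).subst ω) * hωode + (C (m : ℤ_[p])) * hSodeω
  -- uniqueness: `y · (1 + T)^{−mβ}` is constant `1` for both solutions
  set B : PowerSeries ℤ_[p] := binomialSeries ℤ_[p] (-((m : ℤ_[p]) * β)) with hB
  have hBode : (1 + X) * d⁄dX ℤ_[p] B = -C ((m : ℤ_[p]) * β) * B := by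
    rw [← map_neg]; exact one_add_X_mul_derivative_binomialSeries_padicInt _
  have hne : ((1 : PowerSeries ℤ_[p]) + X) ≠ 0 := by
    intro h
    have := congrArg constantCoeff h
    simp at this
  have hconst : ∀ y : PowerSeries ℤ_[p], (1 + X) * d⁄dX ℤ_[p] y = C ((m : ℤ_[p]) * β) * y → constantCoeff y = 1 →
      y * B = 1 := fun y hy hy0 => by
    have hD : d⁄dX ℤ_[p] (y * B) = 0 := by
      refine (mul_eq_zero.mp ?_).resolve_left hne
      rw [Derivation.leibniz, smul_eq_mul, smul_eq_mul]
      linear_combination B * hy + y * hBode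
    have hc : constantCoeff (y * B) = constantCoeff (1 : PowerSeries ℤ_[p]) := by
      rw [map_mul, hy0, hB, binomialSeries_constantCoeff, map_one, mul_one]
    exact derivative.ext (by rw [hD, Derivation.map_one_eq_zero]) hc
  have hW1 : S.subst ω * B = 1 :=
    hconst _ hWode (by
      rw [Literature.Barriers.BirchSwinnertonDyer.constantCoeff_subst_of_constantCoeff_eq_zero hω0, hS,
        binomialSeries_constantCoeff])
  have hV1 : V * B = 1 := hconst _ hVode (by rw [hV, binomialSeries_constantCoeff])
  have hBne : B ≠ 0 := by
    intro h
    have := congrArg constantCoeff h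
    rw [hB, binomialSeries_constantCoeff, map_zero] at this
    exact one_ne_zero this
  exact mul_right_cancel₀ hBne (hW1.trans hV1.symm)

/-! ## §3 The congruence `(1 + T)^α ≡ (1 + T)^a (mod ω_n)` -/

/-- **`ω_m ∣ (1 + T)^{mβ} − 1` in `ℤ_p⟦T⟧`** (`(1 + ω_m)^β − 1 = Σ_{k ≥ 1} C(β,k) ω_m^k`). [cite: Washington1997, §7.2] -/
theorem pow_sub_one_dvd_binomialSeries_sub_one (β : ℤ_[p]) (m : ℕ) :
    (((1 : PowerSeries ℤ_[p]) + X) ^ m - 1) ∣ binomialSeries ℤ_[p] ((m : ℤ_[p]) * β) - 1 := by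
  have hω0 : constantCoeff (((1 : PowerSeries ℤ_[p]) + X) ^ m - 1) = 0 := constantCoeff_one_add_X_pow_sub_one m
  have hω : HasSubst (((1 : PowerSeries ℤ_[p]) + X) ^ m - 1) := HasSubst.of_constantCoeff_zero' hω0
  obtain ⟨S₁, hS₁⟩ : (X : PowerSeries ℤ_[p]) ∣ binomialSeries ℤ_[p] β - 1 :=
    X_dvd_iff.mpr (by rw [map_sub, binomialSeries_constantCoeff, map_one, sub_self])
  refine ⟨S₁.subst (((1 : PowerSeries ℤ_[p]) + X) ^ m - 1), ?_⟩
  rw [← binomialSeries_subst_pow_sub_one, show binomialSeries ℤ_[p] β = 1 + X * S₁ by rw [← hS₁]; ring,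
    subst_add hω, subst_mul hω, subst_X hω, ← coe_substAlgHom hω, map_one, coe_substAlgHom hω]
  ring

/-- ★ **`(1 + T)^α − (1 + T)^a ∈ (ω_n)` for `p^n ∣ α − a`**, in the tree's shape `F − ↑r ∈ Ideal.span {↑ω_n}` with the polynomial
representative `r = (X + 1)^a`. [cite: Washington1997, §7.1–§7.2 and §13.1] -/
theorem binomialSeries_sub_pow_mem_span (α : ℤ_[p]) (a n : ℕ) (h : ((p : ℤ_[p]) ^ n) ∣ α - a) :
    binomialSeries ℤ_[p] α - (((Polynomial.X + 1 : Polynomial ℤ_[p]) ^ a : Polynomial ℤ_[p]) : PowerSeries ℤ_[p]) ∈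
      Ideal.span {(((Polynomial.X + 1 : Polynomial ℤ_[p]) ^ p ^ n - 1 : Polynomial ℤ_[p]) : PowerSeries ℤ_[p])} := by
  obtain ⟨β, hβ⟩ := h
  have hα : α = (a : ℤ_[p]) + ((p ^ n : ℕ) : ℤ_[p]) * β := by rw [Nat.cast_pow, ← hβ]; ring
  have hcoe_a : (((Polynomial.X + 1 : Polynomial ℤ_[p]) ^ a : Polynomial ℤ_[p]) : PowerSeries ℤ_[p]) =
      ((1 : PowerSeries ℤ_[p]) + X) ^ a := by
    rw [Polynomial.coe_pow, Polynomial.coe_add, Polynomial.coe_X, Polynomial.coe_one, add_comm]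
  have hcoe_ω : (((Polynomial.X + 1 : Polynomial ℤ_[p]) ^ p ^ n - 1 : Polynomial ℤ_[p]) : PowerSeries ℤ_[p]) =
      ((1 : PowerSeries ℤ_[p]) + X) ^ p ^ n - 1 := by
    rw [Polynomial.coe_sub, Polynomial.coe_pow, Polynomial.coe_add, Polynomial.coe_X, Polynomial.coe_one, add_comm]
  rw [Ideal.mem_span_singleton, hcoe_a, hcoe_ω, hα, binomialSeries_add, binomialSeries_nat,
    show ((1 : PowerSeries ℤ_[p]) + X) ^ a * binomialSeries ℤ_[p] (((p ^ n : ℕ) : ℤ_[p]) * β) - (1 + X) ^ a =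
      (1 + X) ^ a * (binomialSeries ℤ_[p] (((p ^ n : ℕ) : ℤ_[p]) * β) - 1) by ring]
  exact dvd_mul_of_dvd_right (pow_sub_one_dvd_binomialSeries_sub_one β (p ^ n)) _

/-! ## §4 Evaluation of group-like elements at `u` with `u^{p^n} = 1` -/

/-- ★ **`[γ^α](u − 1) = u^a`**: for a commutative `ℤ_p`-algebra `A`, `u ∈ A` with `u^{p^n} = 1`, `p^n ∣ α − a`, and ANY polynomial
representative `r ≡ (1 + T)^α (mod ω_n)`: `r(u − 1) = u^a` (E34 `aeval_eq_aeval_of_sub_mem_span` + §3).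
[cite: Washington1997, §7.1 and §13.1] -/
theorem aeval_eq_pow_of_binomialSeries {A : Type*} [CommRing A] [Algebra ℤ_[p] A] {u : A} {n : ℕ} (hu : u ^ p ^ n = 1)
    {α : ℤ_[p]} {a : ℕ} (h : ((p : ℤ_[p]) ^ n) ∣ α - a) {r : Polynomial ℤ_[p]}
    (hr : binomialSeries ℤ_[p] α - (r : PowerSeries ℤ_[p]) ∈
      Ideal.span {(((Polynomial.X + 1 : Polynomial ℤ_[p]) ^ p ^ n - 1 : Polynomial ℤ_[p]) : PowerSeries ℤ_[p])}) :
    Polynomial.aeval (u - 1) r = u ^ a := by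
  rw [aeval_eq_aeval_of_sub_mem_span hu hr (binomialSeries_sub_pow_mem_span α a n h), map_pow, map_add,
    Polynomial.aeval_X, map_one, sub_add_cancel]

end Summit.BirchSwinnertonDyer.Rank1Residual.Additive.PerrinRiouUnit

end
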